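import Summits.KontsevichZagierPeriods.KontsevichZagierPeriods.Theorems.K2SymbolChainsJensenIsScissorsToolkit

/-!
# Jensen is scissors — algebra of the rational circle, the Möbius rotation and the directional
# derivative along the last coordinate

Support file for item stmt-KontsevichZagierPeriods-5204 (`JensenIsScissors`, route
KontsevichZagierPeriods/K2SymbolChains). On the rational circle `e(s) = ((1 − s²) + 2is)/(1 + s²)`
(`s = tan(φ/2)`) the squared distance to a centre `α = α₁ + iα₂` is
`W_α(s) = ((1 − s²)/(1 + s²) − α₁)² + (2s/(1 + s²) − α₂)²`, and for a real centre `ρ` it has the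
closed form `W_ρ(s) = ((1 − ρ)² + (1 + ρ)² s²)/(1 + s²)`. The rotation `φ ↦ φ − arg α` is, in the
coordinate `s`, the map `s ↦ P/Q` with `P = α₂ s² + 2α₁ s − α₂`,
`Q = (ρ − α₁) s² + 2α₂ s + (ρ + α₁)`, `ρ = |α|`; we record the polynomial identities behind
"rotation is a change of variables carrying `W_α` to `W_ρ` and preserving `ds/(1 + s²)`":
`P² + Q² = 2ρ(1 + s²)Q`, `P'Q − PQ' = 2ρQ`, the composition identities with the inverse rotation,
and `W_α(s) = W_ρ(P/Q)`. All are identities of rational functions modulo `ρ² = α₁² + α₂²`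
(`linear_combination`). Finally, the value of a Fréchet derivative on `e_last` is the ordinary
derivative along the last coordinate (`fderiv_apply_single_last`). [folklore]
-/

noncomputable section

open MeasureTheory Set
open Literature.NumberTheory.Transcendental Literature.ModelTheory.ExponentialFields

namespace Summit.KontsevichZagierPeriods.K2SymbolChains.JensenIsScissorsProof

open Literature.NumberTheory.Transcendental.KZ

/-! ### Polynomial identities of the Möbius rotation -/

/-- `P² + Q² = 2ρ(1 + s²)Q`. [folklore] -/
theorem rot_sq_add_sq (ρ α₁ α₂ s : ℝ) (hρ : ρ ^ 2 = α₁ ^ 2 + α₂ ^ 2) :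
    (α₂ * s ^ 2 + 2 * α₁ * s - α₂) ^ 2 + ((ρ - α₁) * s ^ 2 + 2 * α₂ * s + (ρ + α₁)) ^ 2 =
      2 * ρ * (1 + s ^ 2) * ((ρ - α₁) * s ^ 2 + 2 * α₂ * s + (ρ + α₁)) := by
  linear_combination (-(1 + s ^ 2) ^ 2) * hρ

/-- `P'Q − PQ' = 2ρQ` (the rotation preserves `ds/(1 + s²)`). [folklore] -/
theorem rot_wronskian (ρ α₁ α₂ s : ℝ) (hρ : ρ ^ 2 = α₁ ^ 2 + α₂ ^ 2) :
    (2 * α₂ * s + 2 * α₁) * ((ρ - α₁) * s ^ 2 + 2 * α₂ * s + (ρ + α₁)) -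
      (α₂ * s ^ 2 + 2 * α₁ * s - α₂) * (2 * (ρ - α₁) * s + 2 * α₂) =
      2 * ρ * ((ρ - α₁) * s ^ 2 + 2 * α₂ * s + (ρ + α₁)) := by
  linear_combination (-2 * (1 + s ^ 2)) * hρ

/-- `Q̃(P/Q) · Q² = 4ρ²Q`, `Q̃` the denominator of the inverse rotation (`α₂ ↦ −α₂`). [folklore] -/
theorem rot_inv_den (ρ α₁ α₂ s : ℝ) (hρ : ρ ^ 2 = α₁ ^ 2 + α₂ ^ 2) :
    (ρ - α₁) * (α₂ * s ^ 2 + 2 * α₁ * s - α₂) ^ 2 -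
      2 * α₂ * (α₂ * s ^ 2 + 2 * α₁ * s - α₂) * ((ρ - α₁) * s ^ 2 + 2 * α₂ * s + (ρ + α₁)) +
      (ρ + α₁) * ((ρ - α₁) * s ^ 2 + 2 * α₂ * s + (ρ + α₁)) ^ 2 =
      4 * ρ ^ 2 * ((ρ - α₁) * s ^ 2 + 2 * α₂ * s + (ρ + α₁)) := by
  linear_combination (ρ * s ^ 4 - 2 * ρ * s ^ 2 - 3 * ρ - α₁ * s ^ 4 + 6 * α₁ * s ^ 2 - α₁ +
    4 * α₂ * s ^ 3 - 4 * α₂ * s) * hρ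

/-- `P̃(P/Q) · Q² = 4ρ² s Q`, `P̃` the numerator of the inverse rotation. [folklore] -/
theorem rot_inv_num (ρ α₁ α₂ s : ℝ) (hρ : ρ ^ 2 = α₁ ^ 2 + α₂ ^ 2) :
    -α₂ * (α₂ * s ^ 2 + 2 * α₁ * s - α₂) ^ 2 +
      2 * α₁ * (α₂ * s ^ 2 + 2 * α₁ * s - α₂) * ((ρ - α₁) * s ^ 2 + 2 * α₂ * s + (ρ + α₁)) +
      α₂ * ((ρ - α₁) * s ^ 2 + 2 * α₂ * s + (ρ + α₁)) ^ 2 =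
      4 * ρ ^ 2 * s * ((ρ - α₁) * s ^ 2 + 2 * α₂ * s + (ρ + α₁)) := by
  linear_combination (-4 * ρ * s ^ 3 - 4 * ρ * s + 4 * α₁ * s ^ 3 - 4 * α₁ * s + α₂ * s ^ 4 -
    6 * α₂ * s ^ 2 + α₂) * hρ

/-- `Q ≥ 0` when `ρ > 0`. [folklore] -/
theorem rot_den_nonneg (ρ α₁ α₂ s : ℝ) (hρ : ρ ^ 2 = α₁ ^ 2 + α₂ ^ 2) (hρ0 : 0 < ρ) :
    0 ≤ (ρ - α₁) * s ^ 2 + 2 * α₂ * s + (ρ + α₁) := by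
  have h := rot_sq_add_sq ρ α₁ α₂ s hρ
  have h2 : 0 ≤ 2 * ρ * (1 + s ^ 2) * ((ρ - α₁) * s ^ 2 + 2 * α₂ * s + (ρ + α₁)) := by
    rw [← h]; positivity
  have h3 : 0 < 2 * ρ * (1 + s ^ 2) := by positivity
  by_contra hlt
  have : 2 * ρ * (1 + s ^ 2) * ((ρ - α₁) * s ^ 2 + 2 * α₂ * s + (ρ + α₁)) < 0 :=
    mul_neg_of_pos_of_neg h3 (not_le.1 hlt)
  linarith

/-- `Q > 0` off its zero set when `ρ > 0`. [folklore] -/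
theorem rot_den_pos {ρ α₁ α₂ s : ℝ} (hρ : ρ ^ 2 = α₁ ^ 2 + α₂ ^ 2) (hρ0 : 0 < ρ)
    (hQ : (ρ - α₁) * s ^ 2 + 2 * α₂ * s + (ρ + α₁) ≠ 0) :
    0 < (ρ - α₁) * s ^ 2 + 2 * α₂ * s + (ρ + α₁) :=
  lt_of_le_of_ne (rot_den_nonneg ρ α₁ α₂ s hρ hρ0) (Ne.symm hQ)

/-- The zero set of `Q` in `s` has at most one point when `ρ > 0`. [folklore] -/
theorem rot_den_eq_zero_subset (ρ α₁ α₂ : ℝ) (hρ : ρ ^ 2 = α₁ ^ 2 + α₂ ^ 2) (hρ0 : 0 < ρ) :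
    {s : ℝ | (ρ - α₁) * s ^ 2 + 2 * α₂ * s + (ρ + α₁) = 0} ⊆ {-α₂ / (ρ - α₁)} := by
  intro s hs
  simp only [mem_setOf_eq] at hs
  simp only [mem_singleton_iff]
  by_cases h1 : ρ - α₁ = 0
  · -- then `α₂ = 0` and `Q = 2ρ ≠ 0`
    have hα₁ : α₁ = ρ := by linarith
    have hα₂ : α₂ = 0 := by
      have : α₂ ^ 2 = 0 := by rw [hα₁] at hρ; linarith
      exact pow_eq_zero_iff (n := 2) (by norm_num) |>.1 this
    rw [hα₁, hα₂] at hs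
    have : 2 * ρ = 0 := by linarith [hs]
    linarith
  · have hsq : ((ρ - α₁) * s + α₂) ^ 2 = 0 := by
      have := hs
      linear_combination (ρ - α₁) * hs - 1 * hρ
    have h0 : (ρ - α₁) * s + α₂ = 0 := pow_eq_zero_iff (n := 2) (by norm_num) |>.1 hsq
    field_simp
    linarith

/-- `W_α(s) = (1 + ρ)² − 2Q/(1 + s²)`. [folklore] -/
theorem W_eq_sub_den (ρ α₁ α₂ s : ℝ) (hρ : ρ ^ 2 = α₁ ^ 2 + α₂ ^ 2) :
    ((1 - s ^ 2) / (1 + s ^ 2) - α₁) ^ 2 + (2 * s / (1 + s ^ 2) - α₂) ^ 2 =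
      (1 + ρ) ^ 2 - 2 * ((ρ - α₁) * s ^ 2 + 2 * α₂ * s + (ρ + α₁)) / (1 + s ^ 2) := by
  have hs : (1 + s ^ 2) ≠ 0 := by positivity
  field_simp
  linear_combination (-(1 + s ^ 2) ^ 2) * hρ

/-- **The rotation carries `W_α` to `W_ρ`**: for `Q ≠ 0`,
`((1−s²)/(1+s²) − α₁)² + (2s/(1+s²) − α₂)² = ((1−ρ)² + (1+ρ)² m²)/(1 + m²)`, `m = P/Q`.
[folklore] -/
theorem rot_W (ρ α₁ α₂ s : ℝ) (hρ : ρ ^ 2 = α₁ ^ 2 + α₂ ^ 2)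
    (hQ : (ρ - α₁) * s ^ 2 + 2 * α₂ * s + (ρ + α₁) ≠ 0) :
    ((1 - s ^ 2) / (1 + s ^ 2) - α₁) ^ 2 + (2 * s / (1 + s ^ 2) - α₂) ^ 2 =
      ((1 - ρ) ^ 2 + (1 + ρ) ^ 2 *
          ((α₂ * s ^ 2 + 2 * α₁ * s - α₂) / ((ρ - α₁) * s ^ 2 + 2 * α₂ * s + (ρ + α₁))) ^ 2) /
        (1 + ((α₂ * s ^ 2 + 2 * α₁ * s - α₂) / ((ρ - α₁) * s ^ 2 + 2 * α₂ * s + (ρ + α₁))) ^ 2) := by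
  rw [W_eq_sub_den ρ α₁ α₂ s hρ]
  set P := α₂ * s ^ 2 + 2 * α₁ * s - α₂ with hP
  set Q := (ρ - α₁) * s ^ 2 + 2 * α₂ * s + (ρ + α₁) with hQ_def
  have hK := rot_sq_add_sq ρ α₁ α₂ s hρ
  rw [← hP, ← hQ_def] at hK
  have hs : (1 + s ^ 2) ≠ 0 := by positivity
  have hPQ : Q ^ 2 + P ^ 2 ≠ 0 := by
    intro h0
    have : Q ^ 2 = 0 := by nlinarith [sq_nonneg P, sq_nonneg Q]
    exact hQ (pow_eq_zero_iff (n := 2) (by norm_num) |>.1 this)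
  have hrhs : ((1 - ρ) ^ 2 + (1 + ρ) ^ 2 * (P / Q) ^ 2) / (1 + (P / Q) ^ 2) =
      ((1 - ρ) ^ 2 * Q ^ 2 + (1 + ρ) ^ 2 * P ^ 2) / (Q ^ 2 + P ^ 2) := by
    field_simp
  rw [hrhs]
  field_simp
  linear_combination (-2 * Q) * hK

end Summit.KontsevichZagierPeriods.K2SymbolChains.JensenIsScissorsProof
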